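import Mathlib
import HarnessLib
import HarnessLib.Audit
import Summits.CriticalPhenomena.Statement
import HarnessLib.Audit.Status.Attr

/-!
Route: WeylWindow

DORMANT since 2026-08-24T06:32:32Z (reconciler: no traction for 6.6 d (last activity item-evidence-added at 2026-08-17T16:05:46Z); parked, not closed — `ledger route dormant route-CriticalPhenomena-WeylWindow --off` to reactivate) — unstaffed, not closed; items shared with open routes are served there. `ledger route dormant <id> --off` reactivates.

# Route WeylWindow — Weyl universality through the window 1 < Δ_ε < 2 — Möbius symmetry transferred
from conformal Poisson–Delaunay devices only via an irrelevant curvature channel, calibrated against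
the free field

It suffices to show X_WW = K ∧ WT ∧ LE ∧ NG, realising card weyl-universality-needs-interaction as
the ORGANISING CONSTRAINT of the
whole Weyl-universality family (conformal-poisson-devices' W/LW, log-polar-proxy-exact-inversion,
Benjamini–Schramm's Density Invariance
Conjecture): a density/Weyl universality statement can only be true for the Ising class through the
channel Δ_ε > d − 2, because the free
field on the same device violates it by an O(1) curvature-scattering term (card N1) and the
curvature coupling ℓ^{Δ_ε−1}(∂² log m)·ε is the
second-order response (card N3). So the route files (K) EnergyShadowSummable — on ℤ³, Σ_x
‖x‖⁻¹|⟨ε₀;ε_x⟩_{β_c}| < ∞ (Δ_ε > 1 in summable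
form; exactly one logarithm beyond Lebowitz + infrared bound) — as the rank-2 crux; (WT)
WeylTransfer — the device deliverable stated
CONDITIONALLY on K: every normalised, translation-invariant, non-degenerate pointwise scaling limit
of the critical ℤ³ correlators is
Möbius covariant for some Δ > 0 (dilations, O(3) and the unit inversion are exact symmetries in law
of the conformal devices; K kills the
only anomaly channel); (LE) LimitExists — bare existence of a non-degenerate pointwise limit for one
ρ; (NG) NonGaussianLimit — shared
item 0636. The free-field witness rides as support (MinimalCouplingCurvatureDefect typed; device
recurrence/homogenisation informal).
Lean: `Summit.CriticalPhenomena.Ising3DConformalLimit.Theses.WeylWindow.Target` (=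
EnergyShadowSummable ∧ WeylTransfer ∧ LimitExists ∧ NonGaussianLimit, each decl below elaborated in
Sketch.lean, rc 0; assembly proved there by pure logic)

## Assembly
Pure logic (theorem assembly_holds in Sketch.lean, axioms propext/Classical.choice/Quot.sound):
LimitExists gives (ρ, S); LimitNormalisation
replaces S by the normalised, translation-invariant S'; WeylTransfer fed with EnergyShadowSummable
gives Δ > 0 with IsMoebiusCovariant Δ S';
NonGaussianLimit gives HasNontrivialU4 S'; ⟨ρ, Δ, S'⟩ is
Literature.Probability.LatticeModels.CritIsing3DConformalLimit = Ising3DConformalLimit.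

Rationale: WHY THIS LINE. The device programme (conformal-poisson-devices: n.n. Ising with ONE coupling on the
Delaunay graph of a Poisson process of intensity
N|x|⁻³dx or N(1+|x|²)⁻³dx is exactly Stab{0,∞}- resp. O(4)-symmetric in law, so one
Weyl-universality statement W transfers Möbius
covariance to the ℤ³ limit) lists "an anomalous non-Weyl response" as an unexcluded failure and
calls itself dimension-uniform; the card
shows both are wrong in an informative way: unit-conductance walks on Del(PPP(c·m)) homogenise to
∇·(m^{1/3}∇) = Δ_g for g = m^{2/3}δ
(HeinAudibertVonluxburg2005, Rousselle2015), whose Green kernel is the Weyl-rescaled flat kernel iff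
R_g = −8Ω^{−5/2}Δ√Ω vanishes
(conformal Laplacian Δ_g − R/8, Kroon2022 §11.3 eqs. (11.23)–(11.24), LeeParker1987), so the
Gaussian rung flunks W, and the Ising rung
passes only because the curvature–energy coupling scales like ℓ^{Δ_ε−1} → 0, i.e. because Δ_ε > 1
(KosPolandSimmonsDuffinVichi2016:
1.412625). Imported areas: conformal geometry (Yamabe operator), homogenisation of random walks on
random graphs, defect/curvature RG;
prior art BenjaminiSchramm1998 Thm 2.1 + §10 (metric invariance and the Density Invariance
Conjecture, "probably only d = 2" — explained
here: jumps are relevant defects since Δ_ε < d − 1). What no prior route does: isolate the ℤ³-side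
input a device proof must spend as a
typed, attackable lattice statement (K ⇐ η > 0 via Lebowitz, so it sits strictly below
AnomalousForcesInteraction's EtaPositive), and
state the device deliverable honestly conditional on it.

RANKED CRUXES. #0 Target (target) — X_WW = EnergyShadowSummable ∧ WeylTransfer ∧ LimitExists ∧
NonGaussianLimit. (why it might fail: WT needs ℤ³↔Poisson–Delaunay universality and a
curvature-channel Ward identity, both open; LE and NG are the shared open existence and
non-triviality problems.) [BenjaminiSchramm1998, DuminilCopinICM2022,
KosPolandSimmonsDuffinVichi2016]
#2 EnergyShadowSummable (crux) — (K, the window input Δ_ε > d − 2 = 1 in summable form) for the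
critical n.n. Ising plus state on ℤ³ and ε_x = σ_xσ_{x+e₁}: Σ_{x} ‖x‖⁻¹ |⟨ε₀ ε_x⟩ − ⟨ε₀⟩⟨ε_x⟩| < ∞
(card N3: the curvature coupling of a C² density is irrelevant iff this holds). [difficulty:
open-problem] (why it might fail: False iff Δ_ε ≤ 1: rigorously only Δ_ε ≥ 1+η ≥ 1 is known
(Lebowitz U₄ ≤ 0 gives ⟨ε;ε⟩ ≤ 2G², IRB/MMS give G ≤ C/‖x‖) — exactly log-divergent; Δ_ε = 1.4126 is
bootstrap numerics and η(3) = 0 is excluded by no theorem.) [KosPolandSimmonsDuffinVichi2016,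
Lebowitz1974, FrohlichSimonSpencer1976, MessagerMiracleSoleJSP1977, DuminilCopinICM2022]
#3 WeylTransfer (crux) — (WT, device deliverable, conditional on K) EnergyShadowSummable → every
pointwise scaling limit S of criticalCorr 3 (any ρ > 0 on (0,1]) that is normalised (S = 0 off
NonCoincident), non-degenerate and translation invariant is Möbius covariant with some Δ > 0.
Intended proof: exact dilation/O(3)/inversion symmetry in law of the |x|⁻³ and (1+|x|²)⁻³
Poisson–Delaunay Ising devices + Weyl universality for C² log-densities, whose only second-order
anomaly (curvature ⊗ ε) is summable by K (card N3/N4, W_{C²}, LW_R). [deps: EnergyShadowSummable]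
[difficulty: open-problem] (why it might fail: ℤ³↔Poisson–Delaunay universality is open (Harris-type
relevance of connectivity disorder not excluded; JankeVillanova2002/BarghathiVojta2014 are numerics)
and a non-Weyl response outside the ε-channel (e.g. a relevant even vector/tensor defect operator)
would survive K.) [BenjaminiSchramm1998, ChristFriedbergLee1982, JankeVillanova2002,
BarghathiVojta2014, LastPenrose2017, Polyakov1970, DuminilCopinICM2022]
#4 LimitExists (crux) — (LE) there are ρ > 0 on (0,1] and S with ρ(δ)ⁿ⟨σ_{[x₁/δ]}⋯σ_{[xₙ/δ]}⟩⁺_{β_c}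
→ S n locally uniformly on non-coincident configurations, S₂ > 0 (no symmetry asked: translations
are automatic, dilations/rotations/inversion are WT's output). [difficulty: open-problem] (why it
might fail: Full-filter convergence of all n-point functions for one ρ is "widely open" on ℤ³
(ICM2022 §8.4); c‖x‖⁻² ≤ G ≤ C‖x‖⁻¹ gives only subsequences, and log-periodic modulations of ρ (card
rp-cannot-fix-the-scale-log-periodic) are not excluded.) [DuminilCopinICM2022,
PolandRychkovVichi2019, Literature.Probability.LatticeModels.criticalTwoPoint_bounds_holds]
#5 NonGaussianLimit (crux) — (NG = shared item stmt-CriticalPhenomena-0636, verbatim) every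
non-degenerate pointwise scaling limit of the renormalised critical correlators on ℤ³ has U₄ ≢ 0.
[difficulty: open-problem] (why it might fail: No proof that U₄ ≢ 0 in d = 3: the double-current
intersection probability at macroscopic separation must stay positive as δ → 0; RP long-range models
on ℤ³ with α < 3/2 ARE Gaussian (LongRangeTrivialityOnZ3).) [AizenmanDuminilCopinAnnals2021,
DuminilCopinICM2022, Aizenman1982]
#9 LimitNormalisation (support) — (glue, provable now) any non-degenerate pointwise scaling limit S
of criticalCorr 3 may be replaced by S' := S·𝟙_{NonCoincident}: still a limit for the same ρ,
non-degenerate, normalised, translation invariant (plusCorr_shift /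
plusExpect_spinProduct_comp_shift + local uniformity: F_δ(x+δm) = F_δ(x)) and continuous on
NonCoincident (δ-cell argument). [difficulty: provable-now] [FriedliVelenik2017,
ChelkakHonglerIzyurov2015]
#9 MinimalCouplingCurvatureDefect (support) — (card N1, continuum half; identity checked
numerically) for Ω ∈ C²(ℝ³), Ω > 0, x ≠ y and w_x(z) = Ω(z)^{−1/2}‖x − z‖⁻¹ (the Weyl-rescaled flat
kernel): Ω(y)Δw_x(y) + ∇Ω(y)·∇w_x(y) = −Δ(√Ω)(y)/‖x − y‖. Hence the minimal-coupling operator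
∇·(Ω∇·) — the homogenised generator of the unit-conductance walk on Del(PPP(c·m)), Ω = m^{1/3} — has
the Weyl-form Green kernel iff Δ√Ω ≡ 0 iff R_{Ω²δ} ≡ 0 (Möbius densities only): the free field
flunks W by an explicit curvature term. [difficulty: M] [Kroon2022, LeeParker1987,
HeinAudibertVonluxburg2005, Rousselle2015]

TWO-LAYER PLAN. Foreseen glued splits, filed only when a crux closes or the device objects are
defined: WeylTransfer ⇐ DeviceExactSymmetry (Möbius
equivariance of the empty-ball rule + Poisson mapping theorem for the |x|⁻³ and (1+|x|²)⁻³ devices;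
provable once Delaunay/annealed
correlators are defined) → CurvatureWardSmooth (local Weyl Ward identity via Mecke/Poisson
integration by parts for C² log-densities, with
contact term Σᵢ[(Δ/3)div v + v·∇ᵢ] and a curvature channel whose coefficient is a ‖x‖⁻¹-weighted
energy two-point sum — vanishing by K
transferred) → SectorIdentification (ℤ³ ↔ homogeneous Poisson–Delaunay: same spin n-point limits and
energy-sector summability) →
WeylTransfer. EnergyShadowSummable ⇐ EtaPositive (shared crux of route AnomalousForcesInteraction: G
≤ C‖x‖^{−1−κ}) → LebowitzEnergyBound
(⟨ε₀;ε_x⟩ ≤ G(x)² + G(x+e₁)G(x−e₁), GKS II for the sign) → EnergyShadowSummable. LimitExists ⇐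
two-point limit (regular variation of ρ) →
n-point tightness/uniqueness → LimitExists.

KILL CRITERIA. ¬EnergyShadowSummable (Δ_ε ≤ 1 on ℤ³) closes the route `refuted:EnergyShadowSummable`
AND retires the whole Weyl-universality family for
Ising (conformal-poisson-devices' W, log-polar proxy cruxes): by the card's window the curvature
channel is then marginal or relevant.
¬WeylTransfer with K in hand (a normalised translation-invariant limit of criticalCorr 3 that is not
Möbius) refutes clause (ii) of the
conjunct itself. A Monte-Carlo W-test on Ising devices whose Weyl violation stays O(1) instead of
decaying like c^{−(Δ_ε−1)/3} ≈ c^{−0.14}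
forces a pivot to SectorIdentification being false (ℤ³ and Poisson–Delaunay in different classes) —
close `refuted:WeylTransfer` then.
¬NonGaussianLimit refutes the conjunct (shared with every route).
IsingEuclidUpgrade/HyperoctahedralRP proving rotations+inversion moots WT.

NOT DECOMPOSED YET. Everything device-side (Delaunay graph of a point configuration, annealed
Poisson–Delaunay Ising correlator, β_c^{PD} ∈ (0,∞), exact-symmetry
lemma, Mecke Ward identity, the jump-defect statement N2 and the d ≥ 5 Gaussian failure N3 of the
card) — these need two definitions first
and are layer-2 children of WeylTransfer; the probabilistic half of the free-field witness
(recurrence of the unit-conductance walk on the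
|x|⁻³ device: the massless harmonic crystal there does not even exist, while W's Gaussian analogue
predicts the kernel
|x|^{1/2}|y|^{1/2}/|x−y|; and the c → ∞ homogenisation to ∇·(m^{1/3}∇)) is filed as an informal
support item, not decomposed.

CHEAPEST FALSIFIER. For K: high-precision series/Monte-Carlo of Σ_{‖x‖≤R}‖x‖⁻¹⟨ε₀;ε_x⟩_{β_c} versus
R — must saturate (tail ∝ R^{−0.83}); growth like log R
kills K and the family. For WT's mechanism: a kit job on 10⁵-point devices — unit-conductance Green
function on Del(PPP(c·m)), m a C² bump,
against the Weyl form m(x)^{−1/6}m(y)^{−1/6}G_flat: the O(1) discrepancy predicted by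
MinimalCouplingCurvatureDefect must APPEAR (if it does
not, the card's homogenisation claim ∇·(m^{1/3}∇) is wrong and the calibration of every device test
with it). Lookup already done: BS98 §10
report DIC numerics in d = 2 only.

NUMBERS. Δ_σ = 0.5181489(10), Δ_ε = 1.412625(10) (KosPolandSimmonsDuffinVichi2016 §1) ⇒ window
margins Δ_ε − (d−2) = 0.4126, (d−1) − Δ_ε = 0.5874;
predicted finite-density Weyl anomaly on Ising devices ∝ c^{−(Δ_ε−1)/3} = c^{−0.1375}; 3D
percolation Δ_ε = 3 − 1/ν ≈ 1.86 (jumps relevant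
there too); conformal coupling in d = 3: ξ = (d−2)/(4(d−1)) = 1/8; R_{Ω²δ} = −8Ω^{−5/2}Δ√Ω;
Barghathi–Vojta criterion (d+1)ν = 2.52 > 2.
Items at open: 8 (target, assembly, 4 cruxes, 2 supports) + 1 informal support to be filed.

DEFINITION REQUESTS. DelaunayGraph (Literature/Probability/LatticeModels or Analysis/FunctionSpaces
next to PointConfig): the SimpleGraph on the points of a
locally finite configuration ω ⊂ EuclideanSpace ℝ (Fin d), p ~ q iff some closed ball has p, q on
its boundary sphere and no point of ω in
its interior. PoissonDelaunayIsingCorr: the annealed correlator E_ω⟨∏σ_{p(xᵢ)}⟩ of the n.n. Ising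
model (isingMeasure on DelaunayGraph ω,
one coupling β, plus b.c., infinite-volume limit) under IsPoissonPointProcess (intensity μ), p(x) =
nearest point of ω. Both requested
with `ledger workitem add --kind definition` after open; cite facts wanted: Rousselle2015 Thm 1.1
(quenched invariance principle on
Poisson–Delaunay), Lebowitz1974 (U₄ ≤ 0).

Novelty: Searches (2026-08-15): `lit search --source crossref` "random walks Delaunay triangulations
invariance principle Rousselle" (8 rows →
Rousselle2015), "Ising three-dimensional random lattices Janke Villanova" (5 → JankeVillanova2002),
"graph Laplacians … Hein Audibert von
Luxburg" (5 → HeinAudibertVonluxburg2005); `lit search --hybrid --source local` "conformal Laplacian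
scalar curvature conformally covariant
Yamabe" (8 held books → Kroon2022 pp. 270–272 read: Yamabe operator, eqs. (11.23)–(11.24)); `lit
galaxy search --star all` "density
invariance Voronoi percolation conformal invariance" (0 rows), "conformally invariant Laplacian" (3
pdf rows: Baston 1990, Gover–Slovák,
Gover–Peterson — conformal differential invariants, no lattice content), "Ising model on random
lattices" (galaxyd saturated, logged);
`lit frontier CriticalPhenomena --since 2023` (30 rows, all planar/SLE/high-d, none on devices or
density universality); openalex 429;
`ledger negatives --problem CriticalPhenomena` (1 row, SAW, unrelated); all five Theses of the sub
and the cards conformal-poisson-devices,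
poisson-delaunay-weyl-mecke (retired), log-polar-proxy-exact-inversion read.
Nearest prior art found: BenjaminiSchramm1998 (doi:10.1007/s002200050443) Thm 2.1 + §10 — metric
invariance of Voronoi percolation in
d = 2, 3 and the Density Invariance Conjecture with the caveat "probably only d = 2"; in-pool
conformal-poisson-devices (W/LW asserted
unconditionally, "dimension-uniform"); textbook conformal Lapla  [refs: 10.1007/s002200050443, doi:10.1007/s002200050443, Rousselle2015, JankeVillanova2002, HeinAudibertVonluxburg2005, Kroon2022, BenjaminiSchramm1998, LeeParker1987]

Barriers (technique_class: density-universality, symmetry-manifesting-discretisation): - technique_class: density-universality, symmetry-manifesting-discretisation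
- Literature.Barriers.CriticalPhenomena.ScaleCovarianceNotMoebius: evaded — WeylTransfer quantifies
only over pointwise limits of criticalCorr 3 (normalised off NonCoincident, the lesson of
IsingEuclidUpgradeRefutations), never over bare Euclidean+scale-covariant families; the barrier's Δ
= 1/2 pair-sum witness is not such a limit, and the symmetry is imported from a second Gibbs model,
not upgraded from symmetry data.
- Literature.Barriers.CriticalPhenomena.LiouvilleRigidity: used as a resource, not met — only Möbius
maps are claimed; it is also WHY the free rung fails off Möbius densities (R_g ≡ 0 exactly for
|J_f|^{1/3} of Möbius f) and why two device types generate everything.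
- Literature.Barriers.CriticalPhenomena.IsingTrivialityFromDimensionFour: consonant — the line is
explicitly d < 4-specific: the window Δ_ε > d − 2 is ν > 1/2, false for the Ising class in d ≥ 4, so
no dimension-uniform Weyl-universality argument is attempted (correcting the device card).
- Literature.Barriers.CriticalPhenomena.LongRangeTrivialityOnZ3: not met for clause (iii)
(NonGaussianLimit is imported, item 0636); for clause (ii) the parallel moral is built in: the
transfer is interaction-specific through K, and the Gaussian model is exhibited as the
counter-witness (MinimalCouplingCurvatureDefect).
- Literature.Barriers.CriticalPhenomena.BootstrapLatticeBlindness: not met — no CFT data or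
bootstrap output is used; Δ_ε

History (route lifecycle, newest last):
- 2026-08-15T11:40:51Z · rev 1: restated Target (stmt-CriticalPhenomena-4735) — Target: inline the crux bodies (gate emits rank 0 before the crux decls, so the by-name conjunction could not elaborate); no change of meaning (planner-plancard-CriticalPhenomena-Ising3DCon-0c0487b1-0)
- 2026-08-24T06:32:32Z · DORMANT — reconciler: no traction for 6.6 d (last activity item-evidence-added at 2026-08-17T16:05:46Z); parked, not closed — `ledger route dormant route-CriticalPhenomen (operator:999:3721822)

sub-problem: Ising3DConformalLimit · status: dormant · opened planner-plancard-CriticalPhenomena-Ising3DCon-0c0487b1-0 2026-08-15T11:34:55Z · rev 3 · ledger route-CriticalPhenomena-WeylWindow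
GENERATED by the gate from the ledger (D-0016/17). Provers cite these decls: `theorem foo : Summit.CriticalPhenomena.Ising3DConformalLimit.Theses.WeylWindow.<Decl> := …` in Summits/CriticalPhenomena/Ising3DConformalLimit/Theorems/<Name>.lean.
-/

namespace Summit.CriticalPhenomena.Ising3DConformalLimit.Theses.WeylWindow

open scoped BigOperators Topology Manifold Classical MeasureTheory ProbabilityTheory Matrix InnerProductSpace ComplexConjugate ContinuousMap
open Filter Set Function TopologicalSpace MeasureTheory

attribute [summit_statement] _root_.Ising3DConformalLimit

-- earlier Target (stmt-CriticalPhenomena-4735, replaced 2026-08-15T11:40:51Z -> stmt-CriticalPhenomena-5351): retired by None — EnergyShadowSummable ∧ WeylTransfer ∧ LimitExists ∧ NonGaussianLimit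
/-- item stmt-CriticalPhenomena-5351 · target · rank 0 · open · by planner
why it might fail: WT needs ℤ³↔Poisson–Delaunay universality and a curvature-channel Ward identity, both open; LE and NG are the shared open existence and non-triviality problems.
sources: BenjaminiSchramm1998, DuminilCopinICM2022, KosPolandSimmonsDuffinVichi2016
[target] X_WW = EnergyShadowSummable ∧ WeylTransfer ∧ LimitExists ∧ NonGaussianLimit, with the four
bodies inlined so that the rank-0 decl elaborates ahead of the cruxes (definitionally equal: Iff.rfl
in the planner Sketch). -/
@[route_item "route-CriticalPhenomena-WeylWindow"]
def Target : Prop :=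
  (Summable (fun x : Literature.Probability.LatticeModels.Site 3 => (‖x‖ : ℝ)⁻¹ * |Literature.Probability.LatticeModels.criticalCorr 3 4 ![0, Pi.single 0 1, x, x + Pi.single 0 1] - Literature.Probability.LatticeModels.criticalCorr 3 2 ![0, Pi.single 0 1] * Literature.Probability.LatticeModels.criticalCorr 3 2 ![x, x + Pi.single 0 1]|)) ∧ ((Summable (fun x : Literature.Probability.LatticeModels.Site 3 => (‖x‖ : ℝ)⁻¹ * |Literature.Probability.LatticeModels.criticalCorr 3 4 ![0, Pi.single 0 1, x, x + Pi.single 0 1] - Literature.Probability.LatticeModels.criticalCorr 3 2 ![0, Pi.single 0 1] * Literature.Probability.LatticeModels.criticalCorr 3 2 ![x, x + Pi.single 0 1]|)) → ∀ (ρ : ℝ → ℝ) (S : Literature.Probability.LatticeModels.CorrFamily 3), (∀ δ ∈ Set.Ioc (0:ℝ) 1, 0 < ρ δ) → Literature.Probability.LatticeModels.HasPointwiseScalingLimit (Literature.Probability.LatticeModels.criticalCorr 3) ρ S → (∀ n z, z ∉ Literature.Probability.LatticeModels.NonCoincident 3 n → S n z = 0) → Literature.Probability.LatticeModels.IsNondegenerateTwoPoint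 S → Literature.Probability.LatticeModels.IsTranslationInvariant S → ∃ Δ : ℝ, 0 < Δ ∧ Literature.Probability.LatticeModels.IsMoebiusCovariant Δ S) ∧ (∃ (ρ : ℝ → ℝ) (S : Literature.Probability.LatticeModels.CorrFamily 3), (∀ δ ∈ Set.Ioc (0:ℝ) 1, 0 < ρ δ) ∧ Literature.Probability.LatticeModels.HasPointwiseScalingLimit (Literature.Probability.LatticeModels.criticalCorr 3) ρ S ∧ Literature.Probability.LatticeModels.IsNondegenerateTwoPoint S) ∧ (∀ (ρ : ℝ → ℝ) (S : Literature.Probability.LatticeModels.CorrFamily 3), (∀ δ ∈ Set.Ioc (0:ℝ) 1, 0 < ρ δ) → Literature.Probability.LatticeModels.HasPointwiseScalingLimit (Literature.Probability.LatticeModels.criticalCorr 3) ρ S → Literature.Probability.LatticeModels.IsNondegenerateTwoPoint S → Literature.Probability.LatticeModels.HasNontrivialU4 S)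

/-- item stmt-CriticalPhenomena-4736 · crux · rank 2 · open · by planner
why it might fail: False iff Δ_ε ≤ 1: rigorously only Δ_ε ≥ 1+η ≥ 1 is known (Lebowitz U₄ ≤ 0 gives ⟨ε;ε⟩ ≤ 2G², IRB/MMS give G ≤ C/‖x‖) — exactly log-divergent; Δ_ε = 1.4126 is bootstrap numerics and η(3) = 0 is excluded by no theorem.
sources: KosPolandSimmonsDuffinVichi2016, Lebowitz1974, FrohlichSimonSpencer1976, MessagerMiracleSoleJSP1977, DuminilCopinICM2022
[crux] (K, the window input Δ_ε > d − 2 = 1 in summable form) for the critical n.n. Ising plus state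
on ℤ³ and ε_x = σ_xσ_{x+e₁}: Σ_{x} ‖x‖⁻¹ |⟨ε₀ ε_x⟩ − ⟨ε₀⟩⟨ε_x⟩| < ∞ (card N3: the curvature coupling
of a C² density is irrelevant iff this holds). [difficulty: open-problem] -/
@[route_item "route-CriticalPhenomena-WeylWindow", crux]
def EnergyShadowSummable : Prop :=
  Summable (fun x : Literature.Probability.LatticeModels.Site 3 => (‖x‖ : ℝ)⁻¹ * |Literature.Probability.LatticeModels.criticalCorr 3 4 ![0, Pi.single 0 1, x, x + Pi.single 0 1] - Literature.Probability.LatticeModels.criticalCorr 3 2 ![0, Pi.single 0 1] * Literature.Probability.LatticeModels.criticalCorr 3 2 ![x, x + Pi.single 0 1]|)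

/-- item stmt-CriticalPhenomena-4737 · crux · rank 3 · open · by planner
why it might fail: ℤ³↔Poisson–Delaunay universality is open (Harris-type relevance of connectivity disorder not excluded; JankeVillanova2002/BarghathiVojta2014 are numerics) and a non-Weyl response outside the ε-channel (e.g. a relevant even vector/tensor defect operator) would survive K.
sources: BenjaminiSchramm1998, ChristFriedbergLee1982, JankeVillanova2002, BarghathiVojta2014, LastPenrose2017, Polyakov1970
[crux] (WT, device deliverable, conditional on K) EnergyShadowSummable → every pointwise scaling
limit S of criticalCorr 3 (any ρ > 0 on (0,1]) that is normalised (S = 0 off NonCoincident),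
non-degenerate and translation invariant is Möbius covariant with some Δ > 0. Intended proof: exact
dilation/O(3)/inversion symmetry in law of the |x|⁻³ and (1+|x|²)⁻³ Poisson–Delaunay Ising devices +
Weyl universality for C² log-densities, whose only second-order anomaly (curvature ⊗ ε) is summable
by K (card N3/N4, W_{C²}, LW_R). [deps: EnergyShadowSummable] [difficulty: open-problem] -/
@[route_item "route-CriticalPhenomena-WeylWindow", crux]
def WeylTransfer : Prop :=
  EnergyShadowSummable → ∀ (ρ : ℝ → ℝ) (S : Literature.Probability.LatticeModels.CorrFamily 3), (∀ δ ∈ Set.Ioc (0:ℝ) 1, 0 < ρ δ) → Literature.Probability.LatticeModels.HasPointwiseScalingLimit (Literature.Probability.LatticeModels.criticalCorr 3) ρ S → (∀ n z, z ∉ Literature.Probability.LatticeModels.NonCoincident 3 n → S n z = 0) → Literature.Probability.LatticeModels.IsNondegenerateTwoPoint S → Literature.Probability.LatticeModels.IsTranslationInvariant S → ∃ Δ : ℝ, 0 < Δ ∧ Literature.Probability.LatticeModels.IsMoebiusCovariant Δ S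

/-- item stmt-CriticalPhenomena-4738 · crux · rank 4 · open · by planner
why it might fail: Full-filter convergence of all n-point functions for one ρ is "widely open" on ℤ³ (ICM2022 §8.4); c‖x‖⁻² ≤ G ≤ C‖x‖⁻¹ gives only subsequences, and log-periodic modulations of ρ (card rp-cannot-fix-the-scale-log-periodic) are not excluded.
sources: DuminilCopinICM2022, PolandRychkovVichi2019, Literature.Probability.LatticeModels.criticalTwoPoint_bounds_holds
[crux] (LE) there are ρ > 0 on (0,1] and S with ρ(δ)ⁿ⟨σ_{[x₁/δ]}⋯σ_{[xₙ/δ]}⟩⁺_{β_c} → S n locally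
uniformly on non-coincident configurations, S₂ > 0 (no symmetry asked: translations are automatic,
dilations/rotations/inversion are WT's output). [difficulty: open-problem] -/
@[route_item "route-CriticalPhenomena-WeylWindow", crux]
def LimitExists : Prop :=
  ∃ (ρ : ℝ → ℝ) (S : Literature.Probability.LatticeModels.CorrFamily 3), (∀ δ ∈ Set.Ioc (0:ℝ) 1, 0 < ρ δ) ∧ Literature.Probability.LatticeModels.HasPointwiseScalingLimit (Literature.Probability.LatticeModels.criticalCorr 3) ρ S ∧ Literature.Probability.LatticeModels.IsNondegenerateTwoPoint S

/-- item stmt-CriticalPhenomena-0636 · crux · rank 5 · open · by planner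
why it might fail: No proof that U₄ ≢ 0 in d = 3: the double-current intersection probability at macroscopic separation must stay positive as δ → 0; RP long-range models on ℤ³ with α < 3/2 ARE Gaussian (LongRangeTrivialityOnZ3).
sources: AizenmanDuminilCopinAnnals2021, DuminilCopinICM2022, Aizenman1982
Crux r4 (non-triviality in d=3): every non-degenerate pointwise scaling limit S of the renormalised
critical Ising correlators on Z^3 has connected four-point function U4 ≢ 0 on non-coincident
configurations. Intended tool: the random-current identity U4(x,y,z,t) =
−2⟨σxσy⟩⟨σzσt⟩·P^{xy,zt}[C_{n1+n2}(x) ∩ C_{n1+n2}(z) ≠ ∅] (Aizenman 1982; ADC2021 arXiv:1912.07973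
eq. (3.11)): non-Gaussianity ⇔ the intersection probability of the two double-current clusters at
macroscopic separation does not vanish as δ → 0. Contrast: for d ≥ 4 every such limit IS Gaussian
(Literature.Probability.LatticeModels.highDim_triviality). Its negation refutes the conjunct
Ising3DConformalLimit itself. -/
@[route_item "route-CriticalPhenomena-WeylWindow", crux]
def NonGaussianLimit : Prop :=
  ∀ (ρ : ℝ → ℝ) (S : Literature.Probability.LatticeModels.CorrFamily 3), (∀ δ ∈ Set.Ioc (0:ℝ) 1, 0 < ρ δ) → Literature.Probability.LatticeModels.HasPointwiseScalingLimit (Literature.Probability.LatticeModels.criticalCorr 3) ρ S → Literature.Probability.LatticeModels.IsNondegenerateTwoPoint S → Literature.Probability.LatticeModels.HasNontrivialU4 S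

/-- item stmt-CriticalPhenomena-14170 · support · rank 9 · open · by planner
[support] Glue Crux… → Target (route-choice repair of `route.target-unreachable`, option (a)):
EnergyShadowSummable → WeylTransfer → LimitExists → NonGaussianLimit → Target. Provable now by pure
logic: since rev 1 `Target` is the four crux bodies inlined (definitionally EnergyShadowSummable ∧
WeylTransfer ∧ LimitExists ∧ NonGaussianLimit, Iff.rfl), so `fun hK hWT hLE hNG => ⟨hK, hWT, hLE,
hNG⟩` closes it (checked in planner Sketch.lean, rc 0, axioms propext/Classical.choice/Quot.sound).
Makes the rank-0 Target reachable from the four ranked cruxes; the deciding theorem `closes` (cruxes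
+ LimitNormalisation → Ising3DConformalLimit) is unchanged. [difficulty: provable-now] Sources:
DuminilCopinICM2022 (§8.4, the conjunct), BenjaminiSchramm1998. -/
@[route_item "route-CriticalPhenomena-WeylWindow"]
def CruxesGiveTarget : Prop :=
  EnergyShadowSummable → WeylTransfer → LimitExists → NonGaussianLimit → Target

/-- item stmt-CriticalPhenomena-4739 · support · rank 9 · open · by planner
sources: FriedliVelenik2017, ChelkakHonglerIzyurov2015
[support] (glue, provable now) any non-degenerate pointwise scaling limit S of criticalCorr 3 may be
replaced by S' := S·𝟙_{NonCoincident}: still a limit for the same ρ, non-degenerate, normalised,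
translation invariant (plusCorr_shift / plusExpect_spinProduct_comp_shift + local uniformity:
F_δ(x+δm) = F_δ(x)) and continuous on NonCoincident (δ-cell argument). [difficulty: provable-now] -/
@[route_item "route-CriticalPhenomena-WeylWindow", crux]
def LimitNormalisation : Prop :=
  ∀ (ρ : ℝ → ℝ) (S : Literature.Probability.LatticeModels.CorrFamily 3), (∀ δ ∈ Set.Ioc (0:ℝ) 1, 0 < ρ δ) → Literature.Probability.LatticeModels.HasPointwiseScalingLimit (Literature.Probability.LatticeModels.criticalCorr 3) ρ S → Literature.Probability.LatticeModels.IsNondegenerateTwoPoint S → ∃ S' : Literature.Probability.LatticeModels.CorrFamily 3, Literature.Probability.LatticeModels.HasPointwiseScalingLimit (Literature.Probability.LatticeModels.criticalCorr 3) ρ S' ∧ (∀ n z, z ∉ Literature.Probability.LatticeModels.NonCoincident 3 n → S' n z = 0) ∧ Literature.Probability.LatticeModels.IsNondegenerateTwoPoint S' ∧ Literature.Probability.LatticeModels.IsTranslationInvariant S' ∧ (∀ n, ContinuousOn (S' n) (Literature.Probability.LatticeModels.NonCoincident 3 n))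

/-- item stmt-CriticalPhenomena-4740 · support · rank 9 · open · by planner
sources: Kroon2022, LeeParker1987, HeinAudibertVonluxburg2005, Rousselle2015
[support] (card N1, continuum half; identity checked numerically) for Ω ∈ C²(ℝ³), Ω > 0, x ≠ y and
w_x(z) = Ω(z)^{−1/2}‖x − z‖⁻¹ (the Weyl-rescaled flat kernel): Ω(y)Δw_x(y) + ∇Ω(y)·∇w_x(y) =
−Δ(√Ω)(y)/‖x − y‖. Hence the minimal-coupling operator ∇·(Ω∇·) — the homogenised generator of the
unit-conductance walk on Del(PPP(c·m)), Ω = m^{1/3} — has the Weyl-form Green kernel iff Δ√Ω ≡ 0 iff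
R_{Ω²δ} ≡ 0 (Möbius densities only): the free field flunks W by an explicit curvature term.
[difficulty: M] -/
@[route_item "route-CriticalPhenomena-WeylWindow"]
def MinimalCouplingCurvatureDefect : Prop :=
  ∀ (Ω : EuclideanSpace ℝ (Fin 3) → ℝ), ContDiff ℝ 2 Ω → (∀ y, 0 < Ω y) → ∀ x y : EuclideanSpace ℝ (Fin 3), y ≠ x → Ω y * Laplacian.laplacian (fun z : EuclideanSpace ℝ (Fin 3) => (Ω z) ^ (-(1 / 2 : ℝ)) * ‖x - z‖⁻¹) y + inner ℝ (gradient Ω y) (gradient (fun z : EuclideanSpace ℝ (Fin 3) => (Ω z) ^ (-(1 / 2 : ℝ)) * ‖x - z‖⁻¹) y) = -(Laplacian.laplacian (fun z : EuclideanSpace ℝ (Fin 3) => Real.sqrt (Ω z)) y) * ‖x - y‖⁻¹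

-- item stmt-CriticalPhenomena-5842 · support · rank 9 · open · by planner — informal only, no Lean statement yet:
--   [support] Card weyl-universality-needs-interaction N1, probabilistic half — the free-field
--   counter-witness ON the devices (calibration for WeylTransfer; not in the assembly). (a) Conformal
--   device: for the Poisson process of intensity N‖x‖⁻³dx on ℝ³∖{0} (N > 0), the simple
--   (unit-conductance) random walk on its Delaunay graph is a.s. RECURRENT — the device is
--   dilation-stationary and quasi-one-dimensional in t = log‖x‖ (4πN points per unit t); Dirichlet
--   principle with test functions linear in t on [0, n] gives effective conductance to infinity ≤
--   n⁻²·Σ_{edges meeting the slab}(Δt)² = O(1/n) → 0, g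

/-- item stmt-CriticalPhenomena-4741 · assembly · rank 1 · open · by planner
sources: DuminilCopinICM2022, BenjaminiSchramm1998
[assembly] EnergyShadowSummable → WeylTransfer → LimitExists → LimitNormalisation → NonGaussianLimit
→ Ising3DConformalLimit. -/
@[route_item "route-CriticalPhenomena-WeylWindow"]
def Assembly : Prop :=
  EnergyShadowSummable → WeylTransfer → LimitExists → LimitNormalisation → NonGaussianLimit → Ising3DConformalLimit

/-! D-0027 §2.1 — DECIDING THEOREM (planner-authored via `route open/edit --closes-file`; by planner-rbadge-CriticalPhenomena-WeylWindow-1c4acfb4-g4-0 2026-08-15T16:11:08Z):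
its hypotheses are this route's items and its conclusion the sub-problem Statement (glue_lint), and it elaborates with this file. -/

@[closes "route-CriticalPhenomena-WeylWindow"] theorem closes (hK : EnergyShadowSummable) (hWT : WeylTransfer) (hLE : LimitExists)
    (hNG : NonGaussianLimit) (hLN : LimitNormalisation) : _root_.Ising3DConformalLimit := by
  -- LimitExists: a renormalisation ρ > 0 on (0,1] and a non-degenerate pointwise limit S
  obtain ⟨ρ, S, hρ, hlim, hnd⟩ := hLE
  -- LimitNormalisation: replace S by the normalised, translation-invariant limit S' (same ρ)
  obtain ⟨S', hlim', hnorm', hnd', htr', -⟩ := hLN ρ S hρ hlim hnd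
  -- WeylTransfer fed with EnergyShadowSummable: S' is Möbius covariant with some Δ > 0
  obtain ⟨Δ, hΔ, hM⟩ := hWT hK ρ S' hρ hlim' hnorm' hnd' htr'
  -- NonGaussianLimit: U₄(S') ≢ 0; ⟨ρ, Δ, S'⟩ witnesses CritIsing3DConformalLimit (= Ising3DConformalLimit)
  exact ⟨ρ, Δ, S', hρ, hΔ, hlim', hnd', hM, hNG ρ S' hρ hlim' hnd'⟩

end Summit.CriticalPhenomena.Ising3DConformalLimit.Theses.WeylWindow
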